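import Summits.QuantumFields.YangMills.Theorems.BalabanUVNodesN18HLayerW1TermInputs226

/-!
# BalabanUVNodes ∕ N18 — THE CONFIGURATION CHAIN OF W1's GENERATOR `𝔇.Gn` KEYED ON node00-def-W1's RECORD OF LOCATED INPUTS: (GEN), `RecAdmissible`, the
# (2.38) pair on the boxes, (1.18), and print's table pair, each from ONE table-based `Inputs226Holo` hypothesis (Track A, DAG node N18 = NE5
# `T4OutputRate.NE5 EA EB W κ θ C₅` :211; cluster K4 «SpineRates»; file 32 of seat pub-ymgap-dag-n18-c, row s1, generation 10)

Cell `pub-ymgap`, HUMAN RULING D-0062 (Track A), R134 ACCELERATION seat `pub-ymgap-dag-n18-c` (strategy s1), generation 10.  THEOREMS ONLY (no `def`, no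
`instance`, no `sorry`); imports file 30 `…N18HLayerW1TermInputs226` (through it files 23 ∕ 24 ∕ 25 ∕ 26 and W1's STOREYS 7–8) BY NAME; restates nothing.

WHY.  Files 28 ∕ 29 gave the five faces of N18's configuration chain at W1's datum — (GEN) for `𝔇.Gn = GenTower.ofTerms L 𝔇.TF`, W1's `RecAdmissible` (the
induction closes), the (2.38) pair `AnalyticH ∧ Bound238` on the boxes `]0, γ]^{k+1}` (what dag-n18-d's junctions and files 9–13 consume), (1.18) for the
generated tower, and `RecAdmissible` on print's table pair — in the walk-record and in the primitive currency, each behind a forest of some fifty located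
binders.  File 30 keyed the per-term schemas on W1's STOREY 8 record; THIS FILE keys the five faces on it: every theorem takes ONE located hypothesis `hloc`
— at every point of every open located-inputs table `big (k+1) Z`, for every term along the history under LEMMA 2's (1.18) guard, a record
`(𝔇 k).Inputs226Holo c Z t s old φ₁ a a₅` whose eleven configuration-dependent fields hold on the table, with the three joint-holomorphy letters — plus the
face's own numerals ([II] Lemma 3's `Lemma3Numerics`, the rate ∕ [KP86] ∕ renewal clauses of files 15–17).  File 31 inhabits `hloc` per term from NODE A's
walk record; the same `hloc` is what N10's and N22's record-keyed sockets read per term.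

WHAT (theorems only; `𝔇 : W1.TermData214 c₀ (F.P K) 𝔸 M L`, estimate record `c`, tables `sp ⊆ big`, `big` open).
* `stepGen_Gn_of_inputs226Holo` — (GEN): activities of `𝔇.Gn k` analytic at the points of `sp (k+1) Z` and (2.38)-bounded there (`A = C₃ε₁`, `R = (1−8δ)·½L·κ`).
* ★ `recAdmissible_Gn_of_inputs226Holo` — W1's `RecAdmissible 𝔇.Gn D (guard class)`: THE INDUCTION CLOSES from the table-based records.
* ★ `hLayer_toClusterTower_Gn_of_inputs226Holo` — the (2.38) pair at every step of `toClusterTower 𝔇.Gn` on `box γ k`.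
* `termBound118_toClusterTower_Gn_of_inputs226Holo` — (1.18) for the generated tower on every history set read inside `D`.
* `recAdmissible_Gn_of_inputs226Holo₂` — `RecAdmissible` on print's table pair (`Z ⊆ X ⇒ sp X ⊆ sp′ Z`, [II] p. 15), the step read on the LARGER table `sp′ ⊆ big`.

HONEST FRAMING — what this is NOT.  Count-neutral by-name knit (files 23 ∕ 24's `…_ofTerms_of_termwise` faces ∘ file 30 §3); NO estimate of Bałaban's is
proved here; `hloc` is a HYPOTHESIS (a record of located inputs per table point — NODE A's kernel records at the configuration, LEMMA 2 along the history,
(2.22), the numerics), the numerals are HYPOTHESES, the datum is DATA.  NOT a discharge of N18 (typed 28∕28 · discharged 5∕27 UNCHANGED); NE5 NOT IN PRINT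
([I] Thm 1 p. 259) and NOT PROVED.  One finite four-torus programme at fixed `ε`, Bałaban as printed — NOT ℝ⁴, NOT infinite volume, NOT OS, NOT a mass gap,
NOT Clay.  0 `sorry`, 0 `def`.

References (TYPES ∕ loci only): [II] = [Balaban1988RG2Cluster] CMP **116** (1988) — (1.41) p. 11, (2.14) p. 15 and the analyticity statement p. 15,
(2.16)–(2.26) pp. 16–17, Lemma 3 (2.38) p. 20, (2.41) p. 21, p. 22; [I] = [Balaban1987RG1] CMP **109** (1987) — (1.18) p. 263, Thm 1 p. 259; [KP86] =
[KoteckyPreiss1986]; [Chae1985] Thm 14.13.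
-/

noncomputable section

open scoped Classical

namespace Summit.QuantumFields.YangMills.BalabanUVNodes.N18HLayerW1TermInputs226Chain

open Set Metric
open scoped BigOperators Matrix Matrix.Norms.L2Operator
open Literature.MathematicalPhysics.QuantumFieldTheory.Balaban1983to89
open Literature.MathematicalPhysics.QuantumFieldTheory.Balaban1983to89.T4Continuum (T4Family)
open Literature.MathematicalPhysics.QuantumFieldTheory.Balaban1983to89.TreeLengthTorus (TDom TPt tsys)
open Literature.MathematicalPhysics.QuantumFieldTheory.Balaban1983to89.B13Lemma3TorusTerms (terms weight)
open Literature.MathematicalPhysics.QuantumFieldTheory.Balaban1983to89.B9Thm37GlueTorus (tdist1)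
open Literature.MathematicalPhysics.QuantumFieldTheory.Balaban1983to89.Node00
open Literature.MathematicalPhysics.QuantumFieldTheory.Balaban1983to89.Node00.Sect2 (domSys domCount CPair)
open Literature.MathematicalPhysics.QuantumFieldTheory.Balaban1983to89.Node00.W1
open Literature.MathematicalPhysics.QuantumFieldTheory.Balaban1983to89.B12TreeDecay (K₀)
open Literature.MathematicalPhysics.QuantumFieldTheory.Balaban1983to89.B13Lemma3TorusSocket (Lemma3Numerics)
open Summit.QuantumFields.YangMills.BalabanUVNodes.N18HLayerW1TermIndexed (stepGen_ofTerms_of_termwise recAdmissible_ofTerms_of_termwise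
  hLayer_toClusterTower_ofTerms_of_termwise termBound118_toClusterTower_ofTerms_of_termwise)
open Summit.QuantumFields.YangMills.BalabanUVNodes.N18HLayerW1TwoRadiiTerms (recAdmissible_ofTerms_of_termwise₂)
open Summit.QuantumFields.YangMills.BalabanUVNodes.N18HLayerW1TermInputs226 (holAnd226_TF_of_inputs226Holo termwiseAn_TF_of_inputs226Holo)

section Located

variable (F : T4Family) (K : ℕ) {𝔸 : Type} [NormedRing 𝔸] [NormedAlgebra ℂ 𝔸] {M : ℕ} [NeZero M] (L : ℕ) [NeZero L]
  {c₀ c : B13.Consts} (𝔇 : TermData214 c₀ (F.P K) 𝔸 M L) (D : Set ℂ)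
  (sp big : (j : ℕ) → (domSys (F.P K) M j).Dom → Set (CPair (F.P K) 𝔸)) {E₀ r₁ a a₅ : ℝ}
  -- the located-inputs tables are OPEN (print's analyticity SPACE (1.15)–(1.17) with the larger radii, [II] p. 15); the (2.26) engine's two numerals
  (hbigo : ∀ (k : ℕ) (Z : (domSys (F.P K) M (k + 1)).Dom), IsOpen (big (k + 1) Z)) (hκ₁ : 1 ≤ c.κ₁) (hα₆ : c.α₆ ≠ 0)

include hbigo hκ₁ hα₆

/-- **(GEN) FOR THE DATUM's GENERATOR `𝔇.Gn` FROM THE TABLE-BASED RECORDS** (file 23 `stepGen_ofTerms_of_termwise`, `hTan` ∕ `hT226 :=` file 30 §3 on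
`sp (k+1) Z ⊆ big (k+1) Z`): for every step, every `s ∈ D` and every older-term table in the guard class the activities `(𝔇.Gn k).H s old · Z` are analytic at
the points of `sp (k+1) Z` and (2.38)-bounded there with `A = C₃ε₁`, `R = (1−8δ)·½L·κ`.
[cite: Balaban1988RG2Cluster, (2.14) p.15 and the analyticity statement p.15, (2.26) p.17 and Lemma 3 (2.38) p.20] -/
theorem stepGen_Gn_of_inputs226Holo
    (hloc : ∀ k : ℕ, ∀ s ∈ D, ∀ old : OlderTerms (F.P K) 𝔸 M k,
      (∀ (j : Fin (k + 1)) (Y : (domSys (F.P K) M j).Dom), ∀ ψ ∈ sp j Y, ‖old j Y ψ‖ ≤ E₀ * Real.exp (-(r₁ * (domSys (F.P K) M j).dj Y))) →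
      (∀ (j : Fin (k + 1)) (Y : (domSys (F.P K) M j).Dom), AnalyticOnNhd ℂ (old j Y) (sp j Y)) →
      ∀ (Z : (domSys (F.P K) M (k + 1)).Dom), ∀ t ∈ terms L M Z, ∀ φ₁ ∈ big (k + 1) Z, ∃ ι : (𝔇 k).Inputs226Holo c Z t s old φ₁ a a₅,
        (∀ φ ∈ big (k + 1) Z, ∀ i j, DifferentiableOn ℂ (fun σ => (𝔇 k).A Z t φ σ i j) {σ | ∀ j, σ j ∈ ι.Uσ}) ∧
        (∀ φ ∈ big (k + 1) Z, ∀ i j, DifferentiableOn ℂ (fun σ => ((𝔇 k).𝒦 Z t).G2 σ ((𝔇 k).uOf Z t φ) i j) {σ | ∀ j, σ j ∈ ι.Uσ}) ∧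
        (∀ σ : TPt (F.P K).d (domCount (F.P K) M (k + 1)) → ℂ, (∀ j, σ j ∈ ι.Uσ) → ∀ i j, DifferentiableOn ℂ (fun φ => (𝔇 k).A Z t φ σ i j) (big (k + 1) Z)) ∧
        (∀ σ : TPt (F.P K).d (domCount (F.P K) M (k + 1)) → ℂ, (∀ j, σ j ∈ ι.Uσ) →
          ∀ i j, DifferentiableOn ℂ (fun φ => ((𝔇 k).𝒦 Z t).G2 σ ((𝔇 k).uOf Z t φ) i j) (big (k + 1) Z)) ∧
        (∀ Y B, DifferentiableOn ℂ (fun φ => (𝔇 k).𝒱 Z t s old φ Y B) (big (k + 1) Z)) ∧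
        (∀ φ ∈ big (k + 1) Z, ∀ Y, Measurable ((𝔇 k).𝒱 Z t s old φ Y)) ∧
        (∀ φ ∈ big (k + 1) Z, ∀ σ : TPt (F.P K).d (domCount (F.P K) M (k + 1)) → ℂ, (∀ j, σ j ∈ ι.Uσ) → ((𝔇 k).A Z t φ σ).IsSymm) ∧
        (∀ φ ∈ big (k + 1) Z, ∀ σ : TPt (F.P K).d (domCount (F.P K) M (k + 1)) → ℂ, (∀ j, σ j ∈ ι.Uσ) → (((𝔇 k).A Z t φ σ).map Complex.re).PosDef) ∧
        (∀ φ ∈ big (k + 1) Z, ∀ τ : TDom (F.P K).d (L * domCount (F.P K) M (k + 1)) → ℂ, (∀ Y, τ Y ∈ ι.Uτ Y) →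
          ∀ B, ∑ Y ∈ t.1, ‖τ Y‖ * ‖(𝔇 k).𝒱 Z t s old φ Y B‖ ≤ ι.a₂₀ / 2 * (B ⬝ᵥ B) + ι.w) ∧
        (∀ φ ∈ big (k + 1) Z, ∀ σ : TPt (F.P K).d (domCount (F.P K) M (k + 1)) → ℂ, (∀ j, σ j ∈ ι.Uσ) → ∀ b j, ‖((𝔇 k).𝒦 Z t).G2 σ ((𝔇 k).uOf Z t φ) b j‖ ≤
            ι.KG * Real.exp (-(ι.kap * tdist1 (𝔇 k).Nf (((𝔇 k).𝒦 Z t).locΛ b) (((𝔇 k).𝒦 Z t).locN j)))) ∧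
        (∀ φ ∈ big (k + 1) Z, ∀ σ : TPt (F.P K).d (domCount (F.P K) M (k + 1)) → ℂ, (∀ j, σ j ∈ ι.Uσ) → ∀ b b', ‖((𝔇 k).A Z t φ σ)⁻¹ b b'‖ ≤
            ι.KCs * Real.exp (-(ι.kap * tdist1 (𝔇 k).Nf (((𝔇 k).𝒦 Z t).locΛ b) (((𝔇 k).𝒦 Z t).locΛ b')))) ∧
        (∀ φ ∈ big (k + 1) Z, ∀ σ : TPt (F.P K).d (domCount (F.P K) M (k + 1)) → ℂ, (∀ j, σ j ∈ ι.Uσ) →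
          ∀ b j, ‖(((𝔇 k).𝒦 Z t).G2 σ ((𝔇 k).uOf Z t φ) - ((𝔇 k).𝒦 Z t).Γ₀.map (algebraMap ℝ ℂ)) b j‖ ≤
            ι.θΓ * Real.exp (-(ι.kap * tdist1 (𝔇 k).Nf (((𝔇 k).𝒦 Z t).locΛ b) (((𝔇 k).𝒦 Z t).locN j)))) ∧
        (∀ φ ∈ big (k + 1) Z, ∀ σ : TPt (F.P K).d (domCount (F.P K) M (k + 1)) → ℂ, (∀ j, σ j ∈ ι.Uσ) →
          ∀ b b', ‖(((𝔇 k).A Z t φ σ)⁻¹ - ((𝔇 k).𝒦 Z t).C.map (algebraMap ℝ ℂ)) b b'‖ ≤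
            ι.θC * Real.exp (-(ι.kap * tdist1 (𝔇 k).Nf (((𝔇 k).𝒦 Z t).locΛ b) (((𝔇 k).𝒦 Z t).locΛ b')))) ∧
        (∀ φ ∈ big (k + 1) Z, ∀ σ : TPt (F.P K).d (domCount (F.P K) M (k + 1)) → ℂ, (∀ j, σ j ∈ ι.Uσ) →
          ∀ b b', ‖((𝔇 k).A Z t φ σ - ((𝔇 k).𝒦 Z t).C⁻¹.map (algebraMap ℝ ℂ)) b b'‖ ≤
            ι.θE * Real.exp (-(ι.kap * tdist1 (𝔇 k).Nf (((𝔇 k).𝒦 Z t).locΛ b) (((𝔇 k).𝒦 Z t).locΛ b')))))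
    (hL8 : 8 ≤ c.L) (hLc : c.L = L) {a₂ a₂' Aabs : ℝ} (hN : Lemma3Numerics c M ((c.L : ℝ) / 2) a a₂ a₂' a₅ Aabs)
    (hbig : ∀ (k : ℕ) (Z : (domSys (F.P K) M (k + 1)).Dom), sp (k + 1) Z ⊆ big (k + 1) Z) :
    ∀ k : ℕ, ∀ s ∈ D, ∀ old : OlderTerms (F.P K) 𝔸 M k,
      (∀ (j : Fin (k + 1)) (Y : (domSys (F.P K) M j).Dom), ∀ ψ ∈ sp j Y,
          ‖old j Y ψ‖ ≤ E₀ * Real.exp (-(r₁ * (domSys (F.P K) M j).dj Y))) →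
      (∀ (j : Fin (k + 1)) (Y : (domSys (F.P K) M j).Dom), AnalyticOnNhd ℂ (old j Y) (sp j Y)) →
      (∀ Z : (domSys (F.P K) M (k + 1)).Dom, AnalyticOnNhd ℂ (fun φ => (𝔇.Gn k).H s old φ Z) (sp (k + 1) Z)) ∧
      (∀ (Z : (domSys (F.P K) M (k + 1)).Dom), ∀ φ ∈ sp (k + 1) Z,
          ‖(𝔇.Gn k).H s old φ Z‖ ≤
            c.C3act * c.ε₁ * Real.exp (-((1 - 8 * c.δ) * ((c.L : ℝ) / 2) * c.κ * (domSys (F.P K) M (k + 1)).dj Z))) :=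
  stepGen_ofTerms_of_termwise F K L 𝔇.TF D sp c hL8 hLc hN
    (termwiseAn_TF_of_inputs226Holo F K L 𝔇 D sp big hbigo hκ₁ hα₆ hloc sp hbig)
    (fun k s hs old hB hAn Z φ hφ t ht =>
      (holAnd226_TF_of_inputs226Holo F K L 𝔇 D sp big hbigo hκ₁ hα₆ hloc k s hs old hB hAn Z t ht).2 φ (hbig k Z hφ))

/-- **★ W1's `RecAdmissible` FOR THE DATUM's GENERATOR FROM THE TABLE-BASED RECORDS** (file 23 `recAdmissible_ofTerms_of_termwise`, both schema binders
discharged by file 30 §3): along every history with values in `D` the generated older terms lie in the class «(1.18)`(E₀,r₁)` on the tables + analytic there» —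
the guard of LEMMA 2's fields of the record: THE INDUCTION CLOSES. [cite: Balaban1987RG1, (1.18) p.263 and Thm 1 p.259; Balaban1988RG2Cluster, (1.41) p.11, (2.14) p.15, (2.26) p.17, p.22] -/
theorem recAdmissible_Gn_of_inputs226Holo
    (hloc : ∀ k : ℕ, ∀ s ∈ D, ∀ old : OlderTerms (F.P K) 𝔸 M k,
      (∀ (j : Fin (k + 1)) (Y : (domSys (F.P K) M j).Dom), ∀ ψ ∈ sp j Y, ‖old j Y ψ‖ ≤ E₀ * Real.exp (-(r₁ * (domSys (F.P K) M j).dj Y))) →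
      (∀ (j : Fin (k + 1)) (Y : (domSys (F.P K) M j).Dom), AnalyticOnNhd ℂ (old j Y) (sp j Y)) →
      ∀ (Z : (domSys (F.P K) M (k + 1)).Dom), ∀ t ∈ terms L M Z, ∀ φ₁ ∈ big (k + 1) Z, ∃ ι : (𝔇 k).Inputs226Holo c Z t s old φ₁ a a₅,
        (∀ φ ∈ big (k + 1) Z, ∀ i j, DifferentiableOn ℂ (fun σ => (𝔇 k).A Z t φ σ i j) {σ | ∀ j, σ j ∈ ι.Uσ}) ∧
        (∀ φ ∈ big (k + 1) Z, ∀ i j, DifferentiableOn ℂ (fun σ => ((𝔇 k).𝒦 Z t).G2 σ ((𝔇 k).uOf Z t φ) i j) {σ | ∀ j, σ j ∈ ι.Uσ}) ∧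
        (∀ σ : TPt (F.P K).d (domCount (F.P K) M (k + 1)) → ℂ, (∀ j, σ j ∈ ι.Uσ) → ∀ i j, DifferentiableOn ℂ (fun φ => (𝔇 k).A Z t φ σ i j) (big (k + 1) Z)) ∧
        (∀ σ : TPt (F.P K).d (domCount (F.P K) M (k + 1)) → ℂ, (∀ j, σ j ∈ ι.Uσ) →
          ∀ i j, DifferentiableOn ℂ (fun φ => ((𝔇 k).𝒦 Z t).G2 σ ((𝔇 k).uOf Z t φ) i j) (big (k + 1) Z)) ∧
        (∀ Y B, DifferentiableOn ℂ (fun φ => (𝔇 k).𝒱 Z t s old φ Y B) (big (k + 1) Z)) ∧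
        (∀ φ ∈ big (k + 1) Z, ∀ Y, Measurable ((𝔇 k).𝒱 Z t s old φ Y)) ∧
        (∀ φ ∈ big (k + 1) Z, ∀ σ : TPt (F.P K).d (domCount (F.P K) M (k + 1)) → ℂ, (∀ j, σ j ∈ ι.Uσ) → ((𝔇 k).A Z t φ σ).IsSymm) ∧
        (∀ φ ∈ big (k + 1) Z, ∀ σ : TPt (F.P K).d (domCount (F.P K) M (k + 1)) → ℂ, (∀ j, σ j ∈ ι.Uσ) → (((𝔇 k).A Z t φ σ).map Complex.re).PosDef) ∧
        (∀ φ ∈ big (k + 1) Z, ∀ τ : TDom (F.P K).d (L * domCount (F.P K) M (k + 1)) → ℂ, (∀ Y, τ Y ∈ ι.Uτ Y) →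
          ∀ B, ∑ Y ∈ t.1, ‖τ Y‖ * ‖(𝔇 k).𝒱 Z t s old φ Y B‖ ≤ ι.a₂₀ / 2 * (B ⬝ᵥ B) + ι.w) ∧
        (∀ φ ∈ big (k + 1) Z, ∀ σ : TPt (F.P K).d (domCount (F.P K) M (k + 1)) → ℂ, (∀ j, σ j ∈ ι.Uσ) → ∀ b j, ‖((𝔇 k).𝒦 Z t).G2 σ ((𝔇 k).uOf Z t φ) b j‖ ≤
            ι.KG * Real.exp (-(ι.kap * tdist1 (𝔇 k).Nf (((𝔇 k).𝒦 Z t).locΛ b) (((𝔇 k).𝒦 Z t).locN j)))) ∧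
        (∀ φ ∈ big (k + 1) Z, ∀ σ : TPt (F.P K).d (domCount (F.P K) M (k + 1)) → ℂ, (∀ j, σ j ∈ ι.Uσ) → ∀ b b', ‖((𝔇 k).A Z t φ σ)⁻¹ b b'‖ ≤
            ι.KCs * Real.exp (-(ι.kap * tdist1 (𝔇 k).Nf (((𝔇 k).𝒦 Z t).locΛ b) (((𝔇 k).𝒦 Z t).locΛ b')))) ∧
        (∀ φ ∈ big (k + 1) Z, ∀ σ : TPt (F.P K).d (domCount (F.P K) M (k + 1)) → ℂ, (∀ j, σ j ∈ ι.Uσ) →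
          ∀ b j, ‖(((𝔇 k).𝒦 Z t).G2 σ ((𝔇 k).uOf Z t φ) - ((𝔇 k).𝒦 Z t).Γ₀.map (algebraMap ℝ ℂ)) b j‖ ≤
            ι.θΓ * Real.exp (-(ι.kap * tdist1 (𝔇 k).Nf (((𝔇 k).𝒦 Z t).locΛ b) (((𝔇 k).𝒦 Z t).locN j)))) ∧
        (∀ φ ∈ big (k + 1) Z, ∀ σ : TPt (F.P K).d (domCount (F.P K) M (k + 1)) → ℂ, (∀ j, σ j ∈ ι.Uσ) →
          ∀ b b', ‖(((𝔇 k).A Z t φ σ)⁻¹ - ((𝔇 k).𝒦 Z t).C.map (algebraMap ℝ ℂ)) b b'‖ ≤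
            ι.θC * Real.exp (-(ι.kap * tdist1 (𝔇 k).Nf (((𝔇 k).𝒦 Z t).locΛ b) (((𝔇 k).𝒦 Z t).locΛ b')))) ∧
        (∀ φ ∈ big (k + 1) Z, ∀ σ : TPt (F.P K).d (domCount (F.P K) M (k + 1)) → ℂ, (∀ j, σ j ∈ ι.Uσ) →
          ∀ b b', ‖((𝔇 k).A Z t φ σ - ((𝔇 k).𝒦 Z t).C⁻¹.map (algebraMap ℝ ℂ)) b b'‖ ≤
            ι.θE * Real.exp (-(ι.kap * tdist1 (𝔇 k).Nf (((𝔇 k).𝒦 Z t).locΛ b) (((𝔇 k).𝒦 Z t).locΛ b')))))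
    (hrestr : ∀ k, W1.SpRestr (sp (k + 1))) (hL8 : 8 ≤ c.L) (hLc : c.L = L)
    {a₂ a₂' Aabs : ℝ} (hN : Lemma3Numerics c M ((c.L : ℝ) / 2) a a₂ a₂' a₅ Aabs)
    (hbig : ∀ (k : ℕ) (Z : (domSys (F.P K) M (k + 1)).Dom), sp (k + 1) Z ⊆ big (k + 1) Z)
    (hr₁ : 0 ≤ r₁) (hApos : 0 ≤ c.C3act * c.ε₁) (hrate : r₁ + 2 * (64 * Real.log 162) + 2 ≤ (1 - 8 * c.δ) * ((c.L : ℝ) / 2) * c.κ)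
    (hKP : c.C3act * c.ε₁ * Real.exp (5 * r₁ + 1) * K₀ 64 8 * 9 * 64 < 1)
    (hrenew : Real.exp 1 * 9 * 64 * K₀ 64 8 ^ 2 * (c.C3act * c.ε₁) ≤ E₀) :
    RecAdmissible 𝔇.Gn D fun k => {old : OlderTerms (F.P K) 𝔸 M k |
      (∀ (j : Fin (k + 1)) (Y : (domSys (F.P K) M j).Dom), ∀ ψ ∈ sp j Y,
          ‖old j Y ψ‖ ≤ E₀ * Real.exp (-(r₁ * (domSys (F.P K) M j).dj Y))) ∧
      (∀ (j : Fin (k + 1)) (Y : (domSys (F.P K) M j).Dom), AnalyticOnNhd ℂ (old j Y) (sp j Y))} :=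
  recAdmissible_ofTerms_of_termwise F K L 𝔇.TF D sp hrestr c hL8 hLc hN
    (termwiseAn_TF_of_inputs226Holo F K L 𝔇 D sp big hbigo hκ₁ hα₆ hloc sp hbig)
    (fun k s hs old hB hAn Z φ hφ t ht =>
      (holAnd226_TF_of_inputs226Holo F K L 𝔇 D sp big hbigo hκ₁ hα₆ hloc k s hs old hB hAn Z t ht).2 φ (hbig k Z hφ))
    hr₁ hApos hrate hKP hrenew

/-- **★ THE (2.38) PAIR AT EVERY STEP OF `toClusterTower 𝔇.Gn` ON THE BOXES `]0, γ]^{k+1}` read inside `D`, FROM THE TABLE-BASED RECORDS** (file 23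
`hLayer_toClusterTower_ofTerms_of_termwise`) — the per-step H-layer hypotheses of files 9–13 and of dag-n18-d's junctions, at the datum, keyed on W1's record.
[cite: Balaban1988RG2Cluster, (2.14) p.15, (2.26) p.17, Lemma 3 (2.38) p.20; Balaban1987RG1, Thm 1 p.259] -/
theorem hLayer_toClusterTower_Gn_of_inputs226Holo
    (hloc : ∀ k : ℕ, ∀ s ∈ D, ∀ old : OlderTerms (F.P K) 𝔸 M k,
      (∀ (j : Fin (k + 1)) (Y : (domSys (F.P K) M j).Dom), ∀ ψ ∈ sp j Y, ‖old j Y ψ‖ ≤ E₀ * Real.exp (-(r₁ * (domSys (F.P K) M j).dj Y))) →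
      (∀ (j : Fin (k + 1)) (Y : (domSys (F.P K) M j).Dom), AnalyticOnNhd ℂ (old j Y) (sp j Y)) →
      ∀ (Z : (domSys (F.P K) M (k + 1)).Dom), ∀ t ∈ terms L M Z, ∀ φ₁ ∈ big (k + 1) Z, ∃ ι : (𝔇 k).Inputs226Holo c Z t s old φ₁ a a₅,
        (∀ φ ∈ big (k + 1) Z, ∀ i j, DifferentiableOn ℂ (fun σ => (𝔇 k).A Z t φ σ i j) {σ | ∀ j, σ j ∈ ι.Uσ}) ∧
        (∀ φ ∈ big (k + 1) Z, ∀ i j, DifferentiableOn ℂ (fun σ => ((𝔇 k).𝒦 Z t).G2 σ ((𝔇 k).uOf Z t φ) i j) {σ | ∀ j, σ j ∈ ι.Uσ}) ∧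
        (∀ σ : TPt (F.P K).d (domCount (F.P K) M (k + 1)) → ℂ, (∀ j, σ j ∈ ι.Uσ) → ∀ i j, DifferentiableOn ℂ (fun φ => (𝔇 k).A Z t φ σ i j) (big (k + 1) Z)) ∧
        (∀ σ : TPt (F.P K).d (domCount (F.P K) M (k + 1)) → ℂ, (∀ j, σ j ∈ ι.Uσ) →
          ∀ i j, DifferentiableOn ℂ (fun φ => ((𝔇 k).𝒦 Z t).G2 σ ((𝔇 k).uOf Z t φ) i j) (big (k + 1) Z)) ∧
        (∀ Y B, DifferentiableOn ℂ (fun φ => (𝔇 k).𝒱 Z t s old φ Y B) (big (k + 1) Z)) ∧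
        (∀ φ ∈ big (k + 1) Z, ∀ Y, Measurable ((𝔇 k).𝒱 Z t s old φ Y)) ∧
        (∀ φ ∈ big (k + 1) Z, ∀ σ : TPt (F.P K).d (domCount (F.P K) M (k + 1)) → ℂ, (∀ j, σ j ∈ ι.Uσ) → ((𝔇 k).A Z t φ σ).IsSymm) ∧
        (∀ φ ∈ big (k + 1) Z, ∀ σ : TPt (F.P K).d (domCount (F.P K) M (k + 1)) → ℂ, (∀ j, σ j ∈ ι.Uσ) → (((𝔇 k).A Z t φ σ).map Complex.re).PosDef) ∧
        (∀ φ ∈ big (k + 1) Z, ∀ τ : TDom (F.P K).d (L * domCount (F.P K) M (k + 1)) → ℂ, (∀ Y, τ Y ∈ ι.Uτ Y) →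
          ∀ B, ∑ Y ∈ t.1, ‖τ Y‖ * ‖(𝔇 k).𝒱 Z t s old φ Y B‖ ≤ ι.a₂₀ / 2 * (B ⬝ᵥ B) + ι.w) ∧
        (∀ φ ∈ big (k + 1) Z, ∀ σ : TPt (F.P K).d (domCount (F.P K) M (k + 1)) → ℂ, (∀ j, σ j ∈ ι.Uσ) → ∀ b j, ‖((𝔇 k).𝒦 Z t).G2 σ ((𝔇 k).uOf Z t φ) b j‖ ≤
            ι.KG * Real.exp (-(ι.kap * tdist1 (𝔇 k).Nf (((𝔇 k).𝒦 Z t).locΛ b) (((𝔇 k).𝒦 Z t).locN j)))) ∧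
        (∀ φ ∈ big (k + 1) Z, ∀ σ : TPt (F.P K).d (domCount (F.P K) M (k + 1)) → ℂ, (∀ j, σ j ∈ ι.Uσ) → ∀ b b', ‖((𝔇 k).A Z t φ σ)⁻¹ b b'‖ ≤
            ι.KCs * Real.exp (-(ι.kap * tdist1 (𝔇 k).Nf (((𝔇 k).𝒦 Z t).locΛ b) (((𝔇 k).𝒦 Z t).locΛ b')))) ∧
        (∀ φ ∈ big (k + 1) Z, ∀ σ : TPt (F.P K).d (domCount (F.P K) M (k + 1)) → ℂ, (∀ j, σ j ∈ ι.Uσ) →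
          ∀ b j, ‖(((𝔇 k).𝒦 Z t).G2 σ ((𝔇 k).uOf Z t φ) - ((𝔇 k).𝒦 Z t).Γ₀.map (algebraMap ℝ ℂ)) b j‖ ≤
            ι.θΓ * Real.exp (-(ι.kap * tdist1 (𝔇 k).Nf (((𝔇 k).𝒦 Z t).locΛ b) (((𝔇 k).𝒦 Z t).locN j)))) ∧
        (∀ φ ∈ big (k + 1) Z, ∀ σ : TPt (F.P K).d (domCount (F.P K) M (k + 1)) → ℂ, (∀ j, σ j ∈ ι.Uσ) →
          ∀ b b', ‖(((𝔇 k).A Z t φ σ)⁻¹ - ((𝔇 k).𝒦 Z t).C.map (algebraMap ℝ ℂ)) b b'‖ ≤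
            ι.θC * Real.exp (-(ι.kap * tdist1 (𝔇 k).Nf (((𝔇 k).𝒦 Z t).locΛ b) (((𝔇 k).𝒦 Z t).locΛ b')))) ∧
        (∀ φ ∈ big (k + 1) Z, ∀ σ : TPt (F.P K).d (domCount (F.P K) M (k + 1)) → ℂ, (∀ j, σ j ∈ ι.Uσ) →
          ∀ b b', ‖((𝔇 k).A Z t φ σ - ((𝔇 k).𝒦 Z t).C⁻¹.map (algebraMap ℝ ℂ)) b b'‖ ≤
            ι.θE * Real.exp (-(ι.kap * tdist1 (𝔇 k).Nf (((𝔇 k).𝒦 Z t).locΛ b) (((𝔇 k).𝒦 Z t).locΛ b')))))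
    {γ : ℝ} (hrestr : ∀ k, W1.SpRestr (sp (k + 1))) (hL8 : 8 ≤ c.L) (hLc : c.L = L)
    {a₂ a₂' Aabs : ℝ} (hN : Lemma3Numerics c M ((c.L : ℝ) / 2) a a₂ a₂' a₅ Aabs)
    (hbig : ∀ (k : ℕ) (Z : (domSys (F.P K) M (k + 1)).Dom), sp (k + 1) Z ⊆ big (k + 1) Z)
    (hr₁ : 0 ≤ r₁) (hApos : 0 ≤ c.C3act * c.ε₁) (hrate : r₁ + 2 * (64 * Real.log 162) + 2 ≤ (1 - 8 * c.δ) * ((c.L : ℝ) / 2) * c.κ)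
    (hKP : c.C3act * c.ε₁ * Real.exp (5 * r₁ + 1) * K₀ 64 8 * 9 * 64 < 1)
    (hrenew : Real.exp 1 * 9 * 64 * K₀ 64 8 ^ 2 * (c.C3act * c.ε₁) ≤ E₀) (hD : ∀ s ∈ Ioc (0 : ℝ) γ, ((s : ℝ) : ℂ) ∈ D) :
    ∀ k, (toClusterTower 𝔇.Gn k).AnalyticH (box γ k) (sp (k + 1)) ∧
      (toClusterTower 𝔇.Gn k).Bound238 (box γ k) (sp (k + 1)) (c.C3act * c.ε₁) ((1 - 8 * c.δ) * ((c.L : ℝ) / 2) * c.κ) :=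
  hLayer_toClusterTower_ofTerms_of_termwise F K L 𝔇.TF D sp hrestr c hL8 hLc hN
    (termwiseAn_TF_of_inputs226Holo F K L 𝔇 D sp big hbigo hκ₁ hα₆ hloc sp hbig)
    (fun k s hs old hB hAn Z φ hφ t ht =>
      (holAnd226_TF_of_inputs226Holo F K L 𝔇 D sp big hbigo hκ₁ hα₆ hloc k s hs old hB hAn Z t ht).2 φ (hbig k Z hφ))
    hr₁ hApos hrate hKP hrenew hD

/-- **(1.18) FOR THE GENERATED TOWER OF THE DATUM on every history set read inside `D`, FROM THE TABLE-BASED RECORDS** (file 23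
`termBound118_toClusterTower_ofTerms_of_termwise`). [cite: Balaban1987RG1, (1.18) p.263 and Thm 1 p.259; Balaban1988RG2Cluster, (2.26) p.17, (2.41) p.21 and p.22] -/
theorem termBound118_toClusterTower_Gn_of_inputs226Holo
    (hloc : ∀ k : ℕ, ∀ s ∈ D, ∀ old : OlderTerms (F.P K) 𝔸 M k,
      (∀ (j : Fin (k + 1)) (Y : (domSys (F.P K) M j).Dom), ∀ ψ ∈ sp j Y, ‖old j Y ψ‖ ≤ E₀ * Real.exp (-(r₁ * (domSys (F.P K) M j).dj Y))) →
      (∀ (j : Fin (k + 1)) (Y : (domSys (F.P K) M j).Dom), AnalyticOnNhd ℂ (old j Y) (sp j Y)) →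
      ∀ (Z : (domSys (F.P K) M (k + 1)).Dom), ∀ t ∈ terms L M Z, ∀ φ₁ ∈ big (k + 1) Z, ∃ ι : (𝔇 k).Inputs226Holo c Z t s old φ₁ a a₅,
        (∀ φ ∈ big (k + 1) Z, ∀ i j, DifferentiableOn ℂ (fun σ => (𝔇 k).A Z t φ σ i j) {σ | ∀ j, σ j ∈ ι.Uσ}) ∧
        (∀ φ ∈ big (k + 1) Z, ∀ i j, DifferentiableOn ℂ (fun σ => ((𝔇 k).𝒦 Z t).G2 σ ((𝔇 k).uOf Z t φ) i j) {σ | ∀ j, σ j ∈ ι.Uσ}) ∧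
        (∀ σ : TPt (F.P K).d (domCount (F.P K) M (k + 1)) → ℂ, (∀ j, σ j ∈ ι.Uσ) → ∀ i j, DifferentiableOn ℂ (fun φ => (𝔇 k).A Z t φ σ i j) (big (k + 1) Z)) ∧
        (∀ σ : TPt (F.P K).d (domCount (F.P K) M (k + 1)) → ℂ, (∀ j, σ j ∈ ι.Uσ) →
          ∀ i j, DifferentiableOn ℂ (fun φ => ((𝔇 k).𝒦 Z t).G2 σ ((𝔇 k).uOf Z t φ) i j) (big (k + 1) Z)) ∧
        (∀ Y B, DifferentiableOn ℂ (fun φ => (𝔇 k).𝒱 Z t s old φ Y B) (big (k + 1) Z)) ∧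
        (∀ φ ∈ big (k + 1) Z, ∀ Y, Measurable ((𝔇 k).𝒱 Z t s old φ Y)) ∧
        (∀ φ ∈ big (k + 1) Z, ∀ σ : TPt (F.P K).d (domCount (F.P K) M (k + 1)) → ℂ, (∀ j, σ j ∈ ι.Uσ) → ((𝔇 k).A Z t φ σ).IsSymm) ∧
        (∀ φ ∈ big (k + 1) Z, ∀ σ : TPt (F.P K).d (domCount (F.P K) M (k + 1)) → ℂ, (∀ j, σ j ∈ ι.Uσ) → (((𝔇 k).A Z t φ σ).map Complex.re).PosDef) ∧
        (∀ φ ∈ big (k + 1) Z, ∀ τ : TDom (F.P K).d (L * domCount (F.P K) M (k + 1)) → ℂ, (∀ Y, τ Y ∈ ι.Uτ Y) →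
          ∀ B, ∑ Y ∈ t.1, ‖τ Y‖ * ‖(𝔇 k).𝒱 Z t s old φ Y B‖ ≤ ι.a₂₀ / 2 * (B ⬝ᵥ B) + ι.w) ∧
        (∀ φ ∈ big (k + 1) Z, ∀ σ : TPt (F.P K).d (domCount (F.P K) M (k + 1)) → ℂ, (∀ j, σ j ∈ ι.Uσ) → ∀ b j, ‖((𝔇 k).𝒦 Z t).G2 σ ((𝔇 k).uOf Z t φ) b j‖ ≤
            ι.KG * Real.exp (-(ι.kap * tdist1 (𝔇 k).Nf (((𝔇 k).𝒦 Z t).locΛ b) (((𝔇 k).𝒦 Z t).locN j)))) ∧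
        (∀ φ ∈ big (k + 1) Z, ∀ σ : TPt (F.P K).d (domCount (F.P K) M (k + 1)) → ℂ, (∀ j, σ j ∈ ι.Uσ) → ∀ b b', ‖((𝔇 k).A Z t φ σ)⁻¹ b b'‖ ≤
            ι.KCs * Real.exp (-(ι.kap * tdist1 (𝔇 k).Nf (((𝔇 k).𝒦 Z t).locΛ b) (((𝔇 k).𝒦 Z t).locΛ b')))) ∧
        (∀ φ ∈ big (k + 1) Z, ∀ σ : TPt (F.P K).d (domCount (F.P K) M (k + 1)) → ℂ, (∀ j, σ j ∈ ι.Uσ) →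
          ∀ b j, ‖(((𝔇 k).𝒦 Z t).G2 σ ((𝔇 k).uOf Z t φ) - ((𝔇 k).𝒦 Z t).Γ₀.map (algebraMap ℝ ℂ)) b j‖ ≤
            ι.θΓ * Real.exp (-(ι.kap * tdist1 (𝔇 k).Nf (((𝔇 k).𝒦 Z t).locΛ b) (((𝔇 k).𝒦 Z t).locN j)))) ∧
        (∀ φ ∈ big (k + 1) Z, ∀ σ : TPt (F.P K).d (domCount (F.P K) M (k + 1)) → ℂ, (∀ j, σ j ∈ ι.Uσ) →
          ∀ b b', ‖(((𝔇 k).A Z t φ σ)⁻¹ - ((𝔇 k).𝒦 Z t).C.map (algebraMap ℝ ℂ)) b b'‖ ≤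
            ι.θC * Real.exp (-(ι.kap * tdist1 (𝔇 k).Nf (((𝔇 k).𝒦 Z t).locΛ b) (((𝔇 k).𝒦 Z t).locΛ b')))) ∧
        (∀ φ ∈ big (k + 1) Z, ∀ σ : TPt (F.P K).d (domCount (F.P K) M (k + 1)) → ℂ, (∀ j, σ j ∈ ι.Uσ) →
          ∀ b b', ‖((𝔇 k).A Z t φ σ - ((𝔇 k).𝒦 Z t).C⁻¹.map (algebraMap ℝ ℂ)) b b'‖ ≤
            ι.θE * Real.exp (-(ι.kap * tdist1 (𝔇 k).Nf (((𝔇 k).𝒦 Z t).locΛ b) (((𝔇 k).𝒦 Z t).locΛ b')))))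
    (hrestr : ∀ k, W1.SpRestr (sp (k + 1))) (hL8 : 8 ≤ c.L) (hLc : c.L = L)
    {a₂ a₂' Aabs : ℝ} (hN : Lemma3Numerics c M ((c.L : ℝ) / 2) a a₂ a₂' a₅ Aabs)
    (hbig : ∀ (k : ℕ) (Z : (domSys (F.P K) M (k + 1)).Dom), sp (k + 1) Z ⊆ big (k + 1) Z)
    (hr₁ : 0 ≤ r₁) (hApos : 0 ≤ c.C3act * c.ε₁) (hrate : r₁ + 2 * (64 * Real.log 162) + 2 ≤ (1 - 8 * c.δ) * ((c.L : ℝ) / 2) * c.κ)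
    (hKP : c.C3act * c.ε₁ * Real.exp (5 * r₁ + 1) * K₀ 64 8 * 9 * 64 < 1)
    (hrenew : Real.exp 1 * 9 * 64 * K₀ 64 8 ^ 2 * (c.C3act * c.ε₁) ≤ E₀) (W : Set (ℕ → ℝ)) (hW : ∀ g ∈ W, ∀ n, ((g n : ℝ) : ℂ) ∈ D) :
    TermBound118 (toClusterTower 𝔇.Gn) W sp E₀ r₁ :=
  termBound118_toClusterTower_ofTerms_of_termwise F K L 𝔇.TF D sp hrestr c hL8 hLc hN
    (termwiseAn_TF_of_inputs226Holo F K L 𝔇 D sp big hbigo hκ₁ hα₆ hloc sp hbig)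
    (fun k s hs old hB hAn Z φ hφ t ht =>
      (holAnd226_TF_of_inputs226Holo F K L 𝔇 D sp big hbigo hκ₁ hα₆ hloc k s hs old hB hAn Z t ht).2 φ (hbig k Z hφ))
    hr₁ hApos hrate hKP hrenew W hW

/-- **W1's `RecAdmissible` ON `sp` FOR THE DATUM's GENERATOR ON PRINT's TABLE PAIR, FROM THE TABLE-BASED RECORDS** (file 24 `recAdmissible_ofTerms_of_termwise₂`):
older terms read on `sp`, the step's (T-an) on the LARGER table `sp′` inside the located-inputs table, the clause `Z ⊆ X ⇒ sp X ⊆ sp′ Z` ([II] p. 15: restrict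
through the (i)–(iii)-space with the larger radii). [cite: Balaban1988RG2Cluster, p.15, (2.14) p.15, (2.26) p.17; Balaban1987RG1, (1.18) p.263 and Thm 1 p.259] -/
theorem recAdmissible_Gn_of_inputs226Holo₂
    (hloc : ∀ k : ℕ, ∀ s ∈ D, ∀ old : OlderTerms (F.P K) 𝔸 M k,
      (∀ (j : Fin (k + 1)) (Y : (domSys (F.P K) M j).Dom), ∀ ψ ∈ sp j Y, ‖old j Y ψ‖ ≤ E₀ * Real.exp (-(r₁ * (domSys (F.P K) M j).dj Y))) →
      (∀ (j : Fin (k + 1)) (Y : (domSys (F.P K) M j).Dom), AnalyticOnNhd ℂ (old j Y) (sp j Y)) →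
      ∀ (Z : (domSys (F.P K) M (k + 1)).Dom), ∀ t ∈ terms L M Z, ∀ φ₁ ∈ big (k + 1) Z, ∃ ι : (𝔇 k).Inputs226Holo c Z t s old φ₁ a a₅,
        (∀ φ ∈ big (k + 1) Z, ∀ i j, DifferentiableOn ℂ (fun σ => (𝔇 k).A Z t φ σ i j) {σ | ∀ j, σ j ∈ ι.Uσ}) ∧
        (∀ φ ∈ big (k + 1) Z, ∀ i j, DifferentiableOn ℂ (fun σ => ((𝔇 k).𝒦 Z t).G2 σ ((𝔇 k).uOf Z t φ) i j) {σ | ∀ j, σ j ∈ ι.Uσ}) ∧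
        (∀ σ : TPt (F.P K).d (domCount (F.P K) M (k + 1)) → ℂ, (∀ j, σ j ∈ ι.Uσ) → ∀ i j, DifferentiableOn ℂ (fun φ => (𝔇 k).A Z t φ σ i j) (big (k + 1) Z)) ∧
        (∀ σ : TPt (F.P K).d (domCount (F.P K) M (k + 1)) → ℂ, (∀ j, σ j ∈ ι.Uσ) →
          ∀ i j, DifferentiableOn ℂ (fun φ => ((𝔇 k).𝒦 Z t).G2 σ ((𝔇 k).uOf Z t φ) i j) (big (k + 1) Z)) ∧
        (∀ Y B, DifferentiableOn ℂ (fun φ => (𝔇 k).𝒱 Z t s old φ Y B) (big (k + 1) Z)) ∧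
        (∀ φ ∈ big (k + 1) Z, ∀ Y, Measurable ((𝔇 k).𝒱 Z t s old φ Y)) ∧
        (∀ φ ∈ big (k + 1) Z, ∀ σ : TPt (F.P K).d (domCount (F.P K) M (k + 1)) → ℂ, (∀ j, σ j ∈ ι.Uσ) → ((𝔇 k).A Z t φ σ).IsSymm) ∧
        (∀ φ ∈ big (k + 1) Z, ∀ σ : TPt (F.P K).d (domCount (F.P K) M (k + 1)) → ℂ, (∀ j, σ j ∈ ι.Uσ) → (((𝔇 k).A Z t φ σ).map Complex.re).PosDef) ∧
        (∀ φ ∈ big (k + 1) Z, ∀ τ : TDom (F.P K).d (L * domCount (F.P K) M (k + 1)) → ℂ, (∀ Y, τ Y ∈ ι.Uτ Y) →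
          ∀ B, ∑ Y ∈ t.1, ‖τ Y‖ * ‖(𝔇 k).𝒱 Z t s old φ Y B‖ ≤ ι.a₂₀ / 2 * (B ⬝ᵥ B) + ι.w) ∧
        (∀ φ ∈ big (k + 1) Z, ∀ σ : TPt (F.P K).d (domCount (F.P K) M (k + 1)) → ℂ, (∀ j, σ j ∈ ι.Uσ) → ∀ b j, ‖((𝔇 k).𝒦 Z t).G2 σ ((𝔇 k).uOf Z t φ) b j‖ ≤
            ι.KG * Real.exp (-(ι.kap * tdist1 (𝔇 k).Nf (((𝔇 k).𝒦 Z t).locΛ b) (((𝔇 k).𝒦 Z t).locN j)))) ∧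
        (∀ φ ∈ big (k + 1) Z, ∀ σ : TPt (F.P K).d (domCount (F.P K) M (k + 1)) → ℂ, (∀ j, σ j ∈ ι.Uσ) → ∀ b b', ‖((𝔇 k).A Z t φ σ)⁻¹ b b'‖ ≤
            ι.KCs * Real.exp (-(ι.kap * tdist1 (𝔇 k).Nf (((𝔇 k).𝒦 Z t).locΛ b) (((𝔇 k).𝒦 Z t).locΛ b')))) ∧
        (∀ φ ∈ big (k + 1) Z, ∀ σ : TPt (F.P K).d (domCount (F.P K) M (k + 1)) → ℂ, (∀ j, σ j ∈ ι.Uσ) →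
          ∀ b j, ‖(((𝔇 k).𝒦 Z t).G2 σ ((𝔇 k).uOf Z t φ) - ((𝔇 k).𝒦 Z t).Γ₀.map (algebraMap ℝ ℂ)) b j‖ ≤
            ι.θΓ * Real.exp (-(ι.kap * tdist1 (𝔇 k).Nf (((𝔇 k).𝒦 Z t).locΛ b) (((𝔇 k).𝒦 Z t).locN j)))) ∧
        (∀ φ ∈ big (k + 1) Z, ∀ σ : TPt (F.P K).d (domCount (F.P K) M (k + 1)) → ℂ, (∀ j, σ j ∈ ι.Uσ) →
          ∀ b b', ‖(((𝔇 k).A Z t φ σ)⁻¹ - ((𝔇 k).𝒦 Z t).C.map (algebraMap ℝ ℂ)) b b'‖ ≤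
            ι.θC * Real.exp (-(ι.kap * tdist1 (𝔇 k).Nf (((𝔇 k).𝒦 Z t).locΛ b) (((𝔇 k).𝒦 Z t).locΛ b')))) ∧
        (∀ φ ∈ big (k + 1) Z, ∀ σ : TPt (F.P K).d (domCount (F.P K) M (k + 1)) → ℂ, (∀ j, σ j ∈ ι.Uσ) →
          ∀ b b', ‖((𝔇 k).A Z t φ σ - ((𝔇 k).𝒦 Z t).C⁻¹.map (algebraMap ℝ ℂ)) b b'‖ ≤
            ι.θE * Real.exp (-(ι.kap * tdist1 (𝔇 k).Nf (((𝔇 k).𝒦 Z t).locΛ b) (((𝔇 k).𝒦 Z t).locΛ b')))))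
    (sp' : (j : ℕ) → (domSys (F.P K) M j).Dom → Set (CPair (F.P K) 𝔸))
    (hrestr : ∀ k, ∀ X Z : (domSys (F.P K) M (k + 1)).Dom, Z.1 ⊆ X.1 → sp (k + 1) X ⊆ sp' (k + 1) Z) (hL8 : 8 ≤ c.L) (hLc : c.L = L)
    {a₂ a₂' Aabs : ℝ} (hN : Lemma3Numerics c M ((c.L : ℝ) / 2) a a₂ a₂' a₅ Aabs)
    (hbig : ∀ (k : ℕ) (Z : (domSys (F.P K) M (k + 1)).Dom), sp' (k + 1) Z ⊆ big (k + 1) Z)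
    (hr₁ : 0 ≤ r₁) (hApos : 0 ≤ c.C3act * c.ε₁) (hrate : r₁ + 2 * (64 * Real.log 162) + 2 ≤ (1 - 8 * c.δ) * ((c.L : ℝ) / 2) * c.κ)
    (hKP : c.C3act * c.ε₁ * Real.exp (5 * r₁ + 1) * K₀ 64 8 * 9 * 64 < 1)
    (hrenew : Real.exp 1 * 9 * 64 * K₀ 64 8 ^ 2 * (c.C3act * c.ε₁) ≤ E₀) :
    RecAdmissible 𝔇.Gn D fun k => {old : OlderTerms (F.P K) 𝔸 M k |
      (∀ (j : Fin (k + 1)) (Y : (domSys (F.P K) M j).Dom), ∀ ψ ∈ sp j Y,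
          ‖old j Y ψ‖ ≤ E₀ * Real.exp (-(r₁ * (domSys (F.P K) M j).dj Y))) ∧
      (∀ (j : Fin (k + 1)) (Y : (domSys (F.P K) M j).Dom), AnalyticOnNhd ℂ (old j Y) (sp j Y))} :=
  recAdmissible_ofTerms_of_termwise₂ F K L 𝔇.TF D sp sp' hrestr c hL8 hLc hN
    (termwiseAn_TF_of_inputs226Holo F K L 𝔇 D sp big hbigo hκ₁ hα₆ hloc sp' hbig)
    (fun k s hs old hB hAn Z φ hφ t ht =>
      (holAnd226_TF_of_inputs226Holo F K L 𝔇 D sp big hbigo hκ₁ hα₆ hloc k s hs old hB hAn Z t ht).2 φ (hbig k Z hφ))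
    hr₁ hApos hrate hKP hrenew

end Located

end Summit.QuantumFields.YangMills.BalabanUVNodes.N18HLayerW1TermInputs226Chain

end
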